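import Literature.Probability.Percolation.TrapPairCut
import HarnessLib

/-!
# The pair step: two disjoint fenced continuations of two arms of the same colour (Menger)

Topic `Literature/Probability/Percolation`; family `crit-perc` / near-critical percolation on `𝕋`.
A brick of the near-critical arm-separation theorem for four arms in the ADJACENT colour
arrangement (P. Nolin, EJP 13 (2008), Thm. 11, `j = 4`, `σ = BBWW` [arXiv 0711.4948: Thm. 10];
the last missing input `hsepAdj` of `Werner2009_lemma63_of_altSeparation_of_adjSeparation`).

Nolin 2008, §4.4, proof of Lemma 15, last paragraph ("If σᵢ has the same color … we then
have no choice … the two crossings cannot be replaced by the same crossing"): two arms of the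
same colour arriving on side `0` of `∂Λ_{2M}` can be continued, disjointly, to two fenced tips of
the lowest-crossing exploration. In the tree the deterministic statement is obtained from
Menger's theorem for two paths (`exists_two_disjoint_paths`): some admissible route exists
(`PairData.hone`) and no admissible site is a cut (`not_isCut_of_not_mem_armSet`,
`not_isCut_of_mem_arm`), whence

* `PairData.menger_hcut` — Menger's second hypothesis;
* `PairData.exists_two_disjoint_routes` — two vertex-disjoint admissible paths from the two
  starts `a 0`, `a 1` to the fence sites of two DISTINCT terms;
* `PairData.Aset_subset_region` — admissible sites lie in `{n ≤ |v| ≤ 2M} ∪ (fence zones)`, open.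

Everything here is proved; no named facts are introduced.

## References

* P. Nolin, Near-critical percolation in two dimensions, *Electron. J. Probab.* 13 (2008), §4.4,
  proof of Lemma 15 (arXiv 0711.4948: Lemma 14), last paragraph [Nolin2008].
* K. Menger, Zur allgemeinen Kurventheorie, *Fund. Math.* 10 (1927); R. Diestel, *Graph Theory*,
  5th ed. (2017), Thm. 3.3.1 [Diestel2017].

Tree: `exists_two_disjoint_paths` (`MengerTwo.lean`), `PairData.*` (`TrapPairSetting.lean`,
`TrapPairRoutes.lean`, `TrapPairCut.lean`), `PathIn.exists_walk`, `PathIn.of_walk_mem_support`.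
-/

noncomputable section

open Set

namespace Literature.Probability.Percolation

open LatticeModels Literature.Combinatorics.SimpleGraph

namespace PairData

variable {M n k₀ K T : ℕ} {ω : SiteConfig (Site 2)}

/-- **No admissible site is a cut** (Menger's second hypothesis). [cite: Nolin2008, §4.4 Lemma 15 (proof) (arXiv 0711.4948: Lemma 14, last paragraph)] -/
theorem menger_hcut (D : PairData M n k₀ K T ω) :
    ∀ zz ∈ D.Aset, ∃ (s t : Site 2) (q : triGraph.Walk s t), s ∈ ({D.a 0, D.a 1} : Set (Site 2)) ∧ t ∈ D.Tset ∧
      (∀ y ∈ q.support, y ∈ D.Aset) ∧ zz ∉ q.support := by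
  intro zz hzz
  by_contra hno
  push Not at hno
  have hcutz : D.IsCut zz := by
    refine ⟨hzz, fun u c z hu hm => ?_⟩
    obtain ⟨i, hp⟩ := hm
    obtain ⟨w, hw⟩ := hp.exists_walk
    have hs : D.a i ∈ ({D.a 0, D.a 1} : Set (Site 2)) := by fin_cases i <;> simp
    exact (hw zz (hno (D.a i) _ w hs (D.m_mem_Tset hu) fun y hy => (hw y hy).1)).2 rfl
  by_cases harm : zz ∈ D.armSet
  · obtain ⟨i, hi⟩ := harm
    exact D.not_isCut_of_mem_arm hi hcutz
  · exact D.not_isCut_of_not_mem_armSet harm hcutz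

/-- The two starts differ. [folklore] -/
theorem a_ne (D : PairData M n k₀ K T ω) : D.a 0 ≠ D.a 1 := fun h =>
  D.disj _ (D.A 0).start_mem_support (by rw [h]; exact (D.A 1).start_mem_support)

/-- **Two disjoint admissible routes to the fences of two distinct terms.** [cite: Nolin2008, §4.4 Lemma 15 (proof) (arXiv 0711.4948: Lemma 14, last paragraph)] [cite: Diestel2017, Thm. 3.3.1] -/
theorem exists_two_disjoint_routes (D : PairData M n k₀ K T ω) :
    ∃ (u₀ u₁ : ℕ) (c₀ c₁ : Finset (Site 2)) (z₀ z₁ : Site 2)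
      (hu₀ : (trapDomain M).lowestSeq ω u₀ = some (c₀, z₀)) (hu₁ : (trapDomain M).lowestSeq ω u₁ = some (c₁, z₁)),
      u₀ ≠ u₁ ∧ ∃ (p₀ : triGraph.Walk (D.a 0) (D.fence hu₀).m) (p₁ : triGraph.Walk (D.a 1) (D.fence hu₁).m),
        p₀.IsPath ∧ p₁.IsPath ∧ (∀ y ∈ p₀.support, y ∈ D.Aset) ∧ (∀ y ∈ p₁.support, y ∈ D.Aset) ∧
        ∀ y ∈ p₀.support, y ∉ p₁.support := by
  classical
  obtain ⟨s₁, t₁, s₂, t₂, p₁, p₂, hs₁, ht₁, hs₂, ht₂, hp₁, hp₂, hA₁, hA₂, hdisj⟩ :=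
    exists_two_disjoint_paths (G := triGraph) D.hone D.menger_hcut
  obtain ⟨v₁, d₁, w₁, hv₁, rfl⟩ := ht₁
  obtain ⟨v₂, d₂, w₂, hv₂, rfl⟩ := ht₂
  have hs : s₁ ≠ s₂ := fun h => hdisj s₁ p₁.start_mem_support (by rw [h]; exact p₂.start_mem_support)
  have ht : (D.fence hv₁).m ≠ (D.fence hv₂).m := fun h => hdisj _ p₁.end_mem_support (by rw [h]; exact p₂.end_mem_support)
  have hv : v₁ ≠ v₂ := by
    rintro rfl
    obtain ⟨rfl, rfl⟩ := term_eq hv₁ hv₂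
    exact ht rfl
  simp only [Set.mem_insert_iff, Set.mem_singleton_iff] at hs₁ hs₂
  rcases hs₁ with rfl | rfl <;> rcases hs₂ with rfl | rfl
  · exact absurd rfl hs
  · exact ⟨v₁, v₂, d₁, d₂, w₁, w₂, hv₁, hv₂, hv, p₁, p₂, hp₁, hp₂, hA₁, hA₂, hdisj⟩
  · exact ⟨v₂, v₁, d₂, d₁, w₂, w₁, hv₂, hv₁, hv.symm, p₂, p₁, hp₂, hp₁, hA₂, hA₁,
      fun y hy hy' => hdisj y hy' hy⟩
  · exact absurd rfl hs

/-- **Admissible sites lie in the annulus or in fence zones, and are open.** [folklore] -/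
theorem Aset_subset_region (D : PairData M n k₀ K T ω) {v : Site 2} (hv : v ∈ D.Aset) :
    v ∈ ω ∧ (v ∈ triAnnSet n (2 * M) ∨ ∃ (u : ℕ) (c : Finset (Site 2)) (z : Site 2)
      (hu : (trapDomain M).lowestSeq ω u = some (c, z)), v ∈ trapFrameZone M z (D.kOf hu)) := by
  refine ⟨D.Aset_subset hv, ?_⟩
  rcases hv with ⟨i, hv⟩ | ⟨u, c, z, hu, hv | hv⟩
  · exact Or.inl (D.supp i v hv).1
  · exact Or.inl (trapD_subset_triAnnSet D.hnM (Finset.mem_coe.2 ((term_isCrossing hu).subset (Finset.mem_coe.1 hv))))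
  · exact Or.inr ⟨u, c, z, hu, ((D.fence hu).F_subset hv).1.1.1⟩

end PairData

end Literature.Probability.Percolation
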